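import Summits.QuantumFields.BalabanUV.T4Continuum.Support.NE7SliceCoarseDatumStraight
import Summits.QuantumFields.BalabanUV.T4Continuum.Support.NE7QuadRemL2Reduction
import HarnessLib

/-!
# NE7CoarseDatumL2Reduction — THE DIRECT ℓ² LETTER (DL2) OF hDL′ REDUCED TO THE LEVEL-WISE ONE-STEP REMAINDERS OF THE STRAIGHT GAUGE COPY (Minkowski form) (memo ROAD-G102 §9 STEP 2, §10)

Cell `pub-balaban`, lineage `t4-ne7-p1` (CRUX PROVER NE7 #1, owner of BINDER row NE7), gen 102; the ℓ² twin of `NE7CoarseDatumL1Reduction`: composition of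
`NE7SliceCoarseDatumStraight.coarseDatum_eq_neg_quadRem_sub` (`φ(u) = −[relIter − dirIter](R′) − dirIter(R′ − R)`), `NE7QuadRemL2Reduction.sqrt_l2sq_relIter_sub_dirIter_le`
(the k-fold quadratic remainder in ℓ², Minkowski form, k-free) and row Π-D's `NE3LinearisedAverageL2.l2sq_dirIter_le_two_term` (the linearised k-fold average in ℓ², k-free, `3 ≤ d`):
  `√dirSq φ(u) (periodBox N) ≤ √(8+384d²L) · ( Σ_{i≤k} √l2sq_{periodBox (L^{k−i}·N)}(E_i(R′)) + √l2sq_{periodBox (L^{k+1}·N)}(R′ − R) )`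
(`dirSq ψ F = l2sq F ψ`), the currency of (DL2) `√dirSq φ ≤ q₂·E_w`.  WHAT REMAINS of (DL2) for gen 103: the level-wise one-step remainders of the straight gauge copy in ℓ²
and the extraction defect in ℓ², against `q₂·E_w` (memo §10.3, §11).
-/

set_option autoImplicit false

open scoped BigOperators Matrix.Norms.L2Operator
open NormedSpace Finset

namespace Summit.QuantumFields.BalabanUV.T4Continuum.NE7CoarseDatumL2Reduction

open Literature.MathematicalPhysics.QuantumFieldTheory.Balaban1983to89
open B7Prop1Explicit B7Prop2Explicit MatrixLog
open T4AveragingDeficitWall (IsUnitaryCfg IsSkewDir SmallField vary Ad dirSq)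
open T4AveragingDeficitWallBoundary (IsPeriodicCfg periodBox)
open AveragingDeficitPeriodicCounting (IsPeriodicDir)
open AveragingDeficitMultiLevelPrep (cpush cavgIter LevelSmall tower radIter)
open BlockAverageVaryHolo (nbRad)
open BlockAveragePushDirGauge (gaugeDir expGauge isPeriodicDir_gaugeDir)
open BlockAverageGaugeExtract (gaugeExtract)
open BlockAverageGaugeExtractCfg (isSkewDir_gaugeExtract isPeriodicDir_gaugeExtract)
open BlockAverageVaryDisc (rho0)
open NE3EnergyShapes (IsUnitarySite IsPeriodicSite)
open NE3TangentCovariantTower (dirIter)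
open NE3LinearisedAverageSup (curvSum)
open NE3QuadRemainderTower (relStep relIter)
open NE3FramePotBoundW (tower_eq_pow_mul levelSmall_pred)
open NE7SliceIterationState (repLog cornerLog coarseDatum)
open NE7SliceIterationStateFacts (repLog_skew repLog_periodic)
open NE3CovariantLineSumsL2 (l2sq l2sq_nonneg sqrt_l2sq_add_le)
open NE3LinearisedAverageL2 (l2sq_dirIter_le_two_term)
open NE7SliceCoarseDatumStraight (coarseDatum_eq_neg_quadRem_sub)
open NE7QuadRemL2Reduction (sqrt_l2sq_relIter_sub_dirIter_le twoTerm_le_C2 sqrt_le_of_sq_le)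

noncomputable section

variable {d : ℕ} {n : Type*} [Fintype n] [DecidableEq n] [Nonempty n]

section State

variable {L : ℕ} (hL : 2 ≤ L) (k : ℕ) {W : Site d → Fin d → (Matrix n n ℂ)ˣ} {x : ℝ} (hWu : IsUnitaryCfg W) (hx : 0 ≤ x) (hsK : LevelSmall d L (k + 1) x)
  (hWx : SmallField W x) (N : ℕ) [NeZero N] (U' : Site d → Fin d → (Matrix n n ℂ)ˣ)
  (hWP : IsPeriodicCfg W ((tower L N (k + 1) : ℕ) : ℤ)) (hU'u : IsUnitaryCfg U') (hU'P : IsPeriodicCfg U' ((tower L N (k + 1) : ℕ) : ℤ))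
  (hA : curvSum d L (k + 1) x ≤ 2 / 3 * L)
  {x' : ℝ} (hx'0 : 0 ≤ x') (hs' : LevelSmall d L k x') (hU'x : SmallField U' x')
  (htop : cavgIter L (k + 1) U' = cavgIter L (k + 1) W)
  {u : Site d → (Matrix n n ℂ)ˣ} (hu : IsUnitarySite u) (huP : IsPeriodicSite u ((tower L N (k + 1) : ℕ) : ℤ))
  (hgauge : gaugeAct u U' = vary W (repLog W U' u) 1) (hX8 : ∀ y κ, ‖repLog W U' u y κ‖ ≤ 1 / 8)
  (hcorner : ∀ z, ((u (((L : ℤ) ^ (k + 1)) • z) : (Matrix n n ℂ)ˣ) : Matrix n n ℂ) = exp (cornerLog L k u z))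
  -- the fine gauge field reading the corner logs
  {Λ : Site d → Matrix n n ℂ} (hΛ : ∀ y, Λ y ∈ skewAdjoint (Matrix n n ℂ))
  (hΛP : ∀ (y : Site d) (i : Fin d), Λ (y + ((tower L N (k + 1) : ℕ) : ℤ) • e i) = Λ y)
  (hread : ∀ z, Λ (((L : ℤ) ^ (k + 1)) • z) = cornerLog L k u z)

variable (hΛs : ∀ y, ‖Λ y‖ < 1 / 64) (hRs : ∀ y μ, ‖(repLog W U' u y μ - gaugeDir W Λ y μ)‖ < 1 / 64)
  {r : ℝ} (hr : ∀ (y : Site d) (μ : Fin d), ‖gaugeExtract W Λ (fun y μ => repLog W U' u y μ - gaugeDir W Λ y μ) y μ‖ ≤ r) (hr1 : r ≤ 1)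
  (hσr : 4 * (3 + 12 * (d : ℝ)) ^ 2 * (L : ℝ) ^ (k + 1) * r ≤ rho0 d L ^ 2) (hsmU : LevelSmall d L k (x + 8 * r))

  (hd : 3 ≤ d) (hN : 1 ≤ N)

include hL hWu hx hsK hWx hWP hU'u hU'P hA hx'0 hs' hU'x htop hu huP hgauge hX8 hcorner hΛ hΛP hread hΛs hRs hr hr1 hσr hsmU hd hN in
/-- **(DL2) REDUCED**: in the setting of `NE7SliceCoarseDatumStraight` ((S1) state on the shifted fibre; `Λ` reading the corner logs; `R = X(u) − gaugeDir W Λ`;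
`R′ = gaugeExtract W Λ R` of sup `r ≤ 1` on the σ-line; enlarged class), with `d ≥ 3`, `N ≥ 1`:
`√dirSq φ(u) (periodBox N) ≤ √C₂ · ( Σ_{i≤k} √l2sq (E_i(R′)) + √l2sq (R′ − R) )`, `C₂ = 8 + 384d²L`. [folklore] -/
theorem sqrt_dirSq_coarseDatum_le :
    Real.sqrt (dirSq (coarseDatum L k W U' u) (periodBox (d := d) N))
      ≤ Real.sqrt (8 + 384 * (d : ℝ) ^ 2 * L)
        * (∑ i ∈ range (k + 1),
              Real.sqrt (l2sq (periodBox (d := d) (L ^ (k + 1 - 1 - i) * N))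
                (fun z κ => relStep L (cavgIter L i W) (relIter L i W (gaugeExtract W Λ (fun y μ => repLog W U' u y μ - gaugeDir W Λ y μ))) z κ
                  - cpush L (cavgIter L i W) (relIter L i W (gaugeExtract W Λ (fun y μ => repLog W U' u y μ - gaugeDir W Λ y μ))) z κ))
            + Real.sqrt (l2sq (periodBox (d := d) (L ^ (k + 1) * N))
                (fun y μ => gaugeExtract W Λ (fun y μ => repLog W U' u y μ - gaugeDir W Λ y μ) y μ - (repLog W U' u y μ - gaugeDir W Λ y μ)))) := by
  have hL1 : 1 ≤ L := by omega
  have hr0 : 0 ≤ r := (norm_nonneg _).trans (hr 0 ⟨0, by omega⟩)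
  have hWP' : IsPeriodicCfg W ((L ^ (k + 1) * N : ℕ) : ℤ) := by rw [← tower_eq_pow_mul]; exact hWP
  have hΛP' : ∀ (y : Site d) (i : Fin d), Λ (y + ((L ^ (k + 1) * N : ℕ) : ℤ) • e i) = Λ y := by rw [← tower_eq_pow_mul]; exact hΛP
  -- class facts of `R` and `R′`
  have hXsk := repLog_skew hWu U' hU'u hu hgauge hX8
  have hRsk : IsSkewDir (fun y μ => repLog W U' u y μ - gaugeDir W Λ y μ) := fun y μ =>
    (skewAdjoint (Matrix n n ℂ)).sub_mem (hXsk y μ)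
      ((skewAdjoint (Matrix n n ℂ)).sub_mem
        (AveragingDeficitTransport.Ad_mem_skewAdjoint ((unitaryUnits (Matrix n n ℂ)).inv_mem (hWu y μ)) (hΛ y)) (hΛ (y + e μ)))
  have hRP : IsPeriodicDir (fun y μ => repLog W U' u y μ - gaugeDir W Λ y μ) ((L ^ (k + 1) * N : ℕ) : ℤ) := by
    intro y i μ
    have hX := repLog_periodic k N U' hWP hU'P huP y i μ
    have hG := isPeriodicDir_gaugeDir hWP hΛP y i μ
    rw [tower_eq_pow_mul] at hX hG
    simp only [hX, hG]
  have hR's : IsSkewDir (gaugeExtract W Λ (fun y μ => repLog W U' u y μ - gaugeDir W Λ y μ)) := isSkewDir_gaugeExtract hWu hΛ hRsk hΛs hRs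
  have hR'P : IsPeriodicDir (gaugeExtract W Λ (fun y μ => repLog W U' u y μ - gaugeDir W Λ y μ)) ((L ^ (k + 1) * N : ℕ) : ℤ) := isPeriodicDir_gaugeExtract hWP' hΛP' hRP
  -- the defect `R′ − R` is skew periodic
  have hDs : IsSkewDir (fun y μ => gaugeExtract W Λ (fun y μ => repLog W U' u y μ - gaugeDir W Λ y μ) y μ - (repLog W U' u y μ - gaugeDir W Λ y μ)) :=
    fun y μ => (skewAdjoint (Matrix n n ℂ)).sub_mem (hR's y μ) (hRsk y μ)
  have hDP : IsPeriodicDir (fun y μ => gaugeExtract W Λ (fun y μ => repLog W U' u y μ - gaugeDir W Λ y μ) y μ - (repLog W U' u y μ - gaugeDir W Λ y μ)) ((tower L N (k + 1) : ℕ) : ℤ) := by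
    intro y i μ
    have h1 := hR'P y i μ
    have h2 := hRP y i μ
    rw [← tower_eq_pow_mul] at h1 h2
    simp only [h1, h2]
  -- (1) the exact form of the coarse datum
  have hφ : coarseDatum L k W U' u = fun z κ =>
      -(relIter L (k + 1) W (gaugeExtract W Λ (fun y μ => repLog W U' u y μ - gaugeDir W Λ y μ)) z κ - dirIter L (k + 1) W (gaugeExtract W Λ (fun y μ => repLog W U' u y μ - gaugeDir W Λ y μ)) z κ)
        + -dirIter L (k + 1) W (fun y μ => gaugeExtract W Λ (fun y μ => repLog W U' u y μ - gaugeDir W Λ y μ) y μ - (repLog W U' u y μ - gaugeDir W Λ y μ)) z κ := by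
    funext z κ
    rw [coarseDatum_eq_neg_quadRem_sub hL k hWu hx hsK hWx N U' hWP hU'u hU'P hA hx'0 hs' hU'x htop hu huP hgauge hX8 hcorner hΛ hΛP hread hΛs hRs hr
      hr1 hσr hsmU z κ, sub_eq_add_neg]
  have hdir : dirSq (coarseDatum L k W U' u) (periodBox (d := d) N) = l2sq (periodBox (d := d) N) (coarseDatum L k W U' u) := rfl
  rw [hdir, hφ]
  have hneg : ∀ (A : Site d → Fin d → Matrix n n ℂ) (F : Finset (Site d)), l2sq F (fun z κ => -A z κ) = l2sq F A := by
    intro A F; unfold l2sq; simp only [norm_neg]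
  refine (sqrt_l2sq_add_le _ _ _).trans ?_
  rw [hneg, hneg]
  -- (2) the quadratic remainder of `R′` in ℓ²
  have hQ := sqrt_l2sq_relIter_sub_dirIter_le (K := k + 1) hd hL hN hWu hWP' hx hsK hWx hA hR's hR'P hr0 hr hσr
  -- (3) the push of the defect in ℓ²
  have hD := l2sq_dirIter_le_two_term hd hL hN k hWu hWP hx (levelSmall_pred k hsK) hWx hDs hDP
  rw [tower_eq_pow_mul, ← add_mul] at hD
  have hD' := (sqrt_le_of_sq_le (by positivity) hD).trans
    (mul_le_mul_of_nonneg_right (Real.sqrt_le_sqrt (twoTerm_le_C2 (m := k + 1) hd hL)) (Real.sqrt_nonneg _))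
  rw [mul_add]
  exact add_le_add hQ hD'

end State

end

end Summit.QuantumFields.BalabanUV.T4Continuum.NE7CoarseDatumL2Reduction
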